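import Summits.Ventures.LatticeQCDFlow.Scaling.BooleanStarLumpedBracket

/-!
HONEST FRAMING: exact (Metropolis-corrected) sampling algorithms for lattice gauge theory; figures
of merit are autocorrelation/cost numbers at stated couplings and volumes; no continuum-physics
claim.

# StarLumpedBracket — S4 (`BooleanStarLumpedBracket`) FOR AN ARBITRARY FINITE CONTENT TYPE: THE SYNCHRONOUS SWAP BRACKET AND THE SHARED REDRAW OF A TYPE-LUMPED TEST
# FUNCTION ON THE HOMOGENEOUS `q`-CONTENT STAR, AND THE LUMPED CERTIFICATE CHECKLIST ⇒ MIXING TIME (lean-2 GEN-33, ours)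

Venture-side (OURS).  Cell `lqcd-flow` (pub-lqcd), unit `pub-lqcd-lean-2-g33`, 2026-08-29.  The foundation that OPEN-MATH item 1 (i) (`q ≥ 3` contents) needs, whatever the
potential turns out to be: on the homogeneous star (persistent hub, `K` idle cold levels of ONE law `μ_1` on a finite content type `S`, identity maps, uniform entry list, exact hot
redraws) under the synchronous coupling of R8, a test function of the pair depending only on the hub pair and the TYPE COUNTS `cnt(x,y)(s,t) = #{i : (x_{i+1}, y_{i+1}) = (s,t)}`
(`(s,t) ∈ S × S`) has a lumped swap bracket (a sum over the `|S|²` level types weighted by their counts, four terms each) and a lumped redraw; so the certificate checklist of S2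
(`starCycle_mixingTime_le_of_idle_supersolution`) is indexed by `(x_0, y_0, cnt)` — the state space of the toy computations of memo-33 §5 (`≈ q²·C(K+q²−1, q²−1)` states).
Verbatim port of S4 with `Bool ↦ S` (S4's generic helpers `card_filter_congr_off`, `uniformList_sum`, `uniformList_card` are imported; `sum_eq_sum_pairTypeS` is the
`S × S` version of `sum_eq_sum_pairType`).

* §1 `sum_eq_sum_pairTypeS`; §2 `homSwap_succ_of_ne` ∕ `homSwap_zero` ∕ `homSwap_level`, `homStar_accept_eq_acc` (`α_r(z) = acc(z_0, z_l)`,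
  `acc(u,v) = min{1, μ_0(v)μ_1(u)/(μ_0(u)μ_1(v))}`), `homStar_cnt_swap_both` ∕ `_left` ∕ `_right`, `homStar_cnt_redraw`;
* §3 **`homStar_entry_bracket_lumped`**, **`homStar_lumped_bracket`**, **`homStar_lumped_redraw`**, and the
  checklist **`homStar_mixingTime_le_of_lumped_supersolution`**: type-lumped `F ≥ 0`, `Ψ` (`0 ≤ Ψ ≤ Ψ_max`, `≥ 1` where a cold level differs) with the lumped bracket and redraw
  inequalities (`0 < ρ ≤ 1`) ⇒ `t_mix(ε) ≤ ⌈(4/((1−t)w_0·ρ))·log((e·Ψ_max+1)/ε)⌉₊`.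

NOT CLAIMED: any certificate for `q ≥ 3` (the potential is open, memo-33 §5); anything measured.  Literature grade (cell rule): OWN, elementary; nothing cited as a fact; no new bib keys.
-/

noncomputable section
open Finset Function
open Literature.Probability.MarkovChains

namespace Summit.Ventures.LatticeQCDFlow.Scaling

/-! ## §1 Counting by level type -/

/-- Summing a function of the two contents at each level = summing over the content pairs weighted by their counts. [ours] -/
theorem sum_eq_sum_pairTypeS {K : ℕ} {S : Type*} [Fintype S] [DecidableEq S] (u v : Fin K → S) (f : S → S → ℝ) :
    ∑ i : Fin K, f (u i) (v i) = ∑ st : S × S, ((univ.filter fun i : Fin K => u i = st.1 ∧ v i = st.2).card : ℝ) * f st.1 st.2 := by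
  have h1 : ∀ i : Fin K, f (u i) (v i) = ∑ st : S × S, (if u i = st.1 ∧ v i = st.2 then (1 : ℝ) else 0) * f st.1 st.2 := by
    intro i
    rw [Finset.sum_eq_single (u i, v i)]
    · simp
    · rintro st _ hst
      rw [if_neg, zero_mul]
      rintro ⟨h1, h2⟩; exact hst (Prod.ext h1.symm h2.symm)
    · intro h; exact absurd (mem_univ _) h
  simp_rw [h1]
  rw [Finset.sum_comm]
  refine sum_congr rfl fun st _ => ?_
  rw [← Finset.sum_mul, Finset.sum_boole]

/-! ## §2 The homogeneous star on a finite content type: swap, acceptances, type counts -/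

variable {K m : ℕ} {S : Type*} [Fintype S] [DecidableEq S] {μ : Fin (K + 1) → S → ℝ}
variable (κ : Fin m → Fin K)

omit [Fintype S] [DecidableEq S] in
/-- The swap image through the identity map: level `0` receives `x_l`, level `l` receives `x_0`, nothing else moves. [ours] -/
theorem homSwap_apply (r : Fin m) (x : Fin (K + 1) → S) (k : Fin (K + 1)) :
    edgeFlowSwap (Equiv.refl S) 0 (κ r).succ x k
      = if k = 0 then x (κ r).succ else if k = (κ r).succ then x 0 else x k := by
  have hl : (0 : Fin (K + 1)) ≠ (κ r).succ := (Fin.succ_ne_zero (κ r)).symm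
  by_cases h0 : k = 0
  · subst h0; rw [if_pos rfl, edgeFlowSwap_fst _ hl]; rfl
  · rw [if_neg h0]
    by_cases hl' : k = (κ r).succ
    · subst hl'; rw [if_pos rfl, edgeFlowSwap_snd]; rfl
    · rw [if_neg hl', edgeFlowSwap_of_ne _ _ _ _ h0 hl']

omit [Fintype S] [DecidableEq S] in
/-- Off the rung level and the hub, the identity-map swap changes nothing: `(e_r x)_{j+1} = x_{j+1}` for `j ≠ κ_r`. [ours] -/
theorem homSwap_succ_of_ne (r : Fin m) (x : Fin (K + 1) → S) {j : Fin K} (hj : j ≠ κ r) :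
    edgeFlowSwap (Equiv.refl S) 0 (κ r).succ x j.succ = x j.succ := by
  rw [homSwap_apply κ r x j.succ, if_neg (Fin.succ_ne_zero j), if_neg (fun h => hj (Fin.succ_injective _ h))]

omit [Fintype S] [DecidableEq S] in
/-- The swap puts the rung level's content at the hub. [ours] -/
theorem homSwap_zero (r : Fin m) (x : Fin (K + 1) → S) : edgeFlowSwap (Equiv.refl S) 0 (κ r).succ x 0 = x (κ r).succ := by
  rw [homSwap_apply κ r x 0, if_pos rfl]

omit [Fintype S] [DecidableEq S] in
/-- The swap puts the hub's content at the rung level. [ours] -/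
theorem homSwap_level (r : Fin m) (x : Fin (K + 1) → S) : edgeFlowSwap (Equiv.refl S) 0 (κ r).succ x (κ r).succ = x 0 := by
  rw [homSwap_apply κ r x (κ r).succ, if_neg (Fin.succ_ne_zero _), if_pos rfl]

omit [DecidableEq S] in
/-- **The acceptance through the two touched bits (homogeneous cold laws):** `α_r(z) = acc(z_0, z_l)` with `acc(u,v) = min{1, μ_0(v)μ_1(u)/(μ_0(u)μ_1(v))}`. [ours] -/
theorem homStar_accept_eq_acc (hμ : ∀ k x, 0 < μ k x) (hhom : ∀ i : Fin K, μ i.succ = μ 1)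
    {α : Fin m → (Fin (K + 1) → S) → ℝ}
    (hα : ∀ r z, α r z = min 1 (tensorFun μ (edgeFlowSwap (Equiv.refl S) 0 (κ r).succ z) / tensorFun μ z))
    {acc : S → S → ℝ} (hacc : ∀ u v, acc u v = min 1 (μ 0 v * μ 1 u / (μ 0 u * μ 1 v)))
    (r : Fin m) (z : Fin (K + 1) → S) : α r z = acc (z 0) (z (κ r).succ) := by
  have h := accept_mul_pair κ (fun _ : Fin m => Equiv.refl S) hμ hα r z
  simp only [Equiv.refl_symm, Equiv.refl_apply] at h
  rw [hhom] at h
  have hA : 0 < μ 0 (z 0) * μ 1 (z (κ r).succ) := mul_pos (hμ _ _) (hμ _ _)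
  have h2 : α r z = min (μ 0 (z 0) * μ 1 (z (κ r).succ)) (μ 0 (z (κ r).succ) * μ 1 (z 0)) / (μ 0 (z 0) * μ 1 (z (κ r).succ)) := by
    rw [eq_div_iff hA.ne']; exact h
  rw [h2, hacc, ← min_div_div_right hA.le, div_self hA.ne']

section Counts
variable {cnt : (Fin (K + 1) → S) × (Fin (K + 1) → S) → S → S → ℝ}

omit [Fintype S] in
/-- **Type counts after a joint swap:** only the rung level changes type, from `(x_l, y_l)` to the old hub pair `(x_0, y_0)`. [ours] -/
theorem homStar_cnt_swap_both (hcnt : ∀ a s t, cnt a s t = ((univ.filter fun i : Fin K => a.1 i.succ = s ∧ a.2 i.succ = t).card : ℝ))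
    (r : Fin m) (x y : Fin (K + 1) → S) (s t : S) :
    cnt (edgeFlowSwap (Equiv.refl S) 0 (κ r).succ x, edgeFlowSwap (Equiv.refl S) 0 (κ r).succ y) s t
      = cnt (x, y) s t - (if x (κ r).succ = s ∧ y (κ r).succ = t then 1 else 0) + (if x 0 = s ∧ y 0 = t then 1 else 0) := by
  rw [hcnt, hcnt]
  dsimp only
  rw [card_filter_congr_off (fun i : Fin K => x i.succ = s ∧ y i.succ = t)
    (fun i : Fin K => edgeFlowSwap (Equiv.refl S) 0 (κ r).succ x i.succ = s ∧ edgeFlowSwap (Equiv.refl S) 0 (κ r).succ y i.succ = t) (κ r)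
    (fun j hj => by rw [homSwap_succ_of_ne κ r x hj, homSwap_succ_of_ne κ r y hj])]
  simp only [homSwap_level]

omit [Fintype S] in
/-- Type counts after a swap of the first copy only: the rung level becomes `(x_0, y_l)`. [ours] -/
theorem homStar_cnt_swap_left (hcnt : ∀ a s t, cnt a s t = ((univ.filter fun i : Fin K => a.1 i.succ = s ∧ a.2 i.succ = t).card : ℝ))
    (r : Fin m) (x y : Fin (K + 1) → S) (s t : S) :
    cnt (edgeFlowSwap (Equiv.refl S) 0 (κ r).succ x, y) s t
      = cnt (x, y) s t - (if x (κ r).succ = s ∧ y (κ r).succ = t then 1 else 0) + (if x 0 = s ∧ y (κ r).succ = t then 1 else 0) := by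
  rw [hcnt, hcnt]
  dsimp only
  rw [card_filter_congr_off (fun i : Fin K => x i.succ = s ∧ y i.succ = t)
    (fun i : Fin K => edgeFlowSwap (Equiv.refl S) 0 (κ r).succ x i.succ = s ∧ y i.succ = t) (κ r)
    (fun j hj => by rw [homSwap_succ_of_ne κ r x hj])]
  simp only [homSwap_level]

omit [Fintype S] in
/-- Type counts after a swap of the second copy only: the rung level becomes `(x_l, y_0)`. [ours] -/
theorem homStar_cnt_swap_right (hcnt : ∀ a s t, cnt a s t = ((univ.filter fun i : Fin K => a.1 i.succ = s ∧ a.2 i.succ = t).card : ℝ))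
    (r : Fin m) (x y : Fin (K + 1) → S) (s t : S) :
    cnt (x, edgeFlowSwap (Equiv.refl S) 0 (κ r).succ y) s t
      = cnt (x, y) s t - (if x (κ r).succ = s ∧ y (κ r).succ = t then 1 else 0) + (if x (κ r).succ = s ∧ y 0 = t then 1 else 0) := by
  rw [hcnt, hcnt]
  dsimp only
  rw [card_filter_congr_off (fun i : Fin K => x i.succ = s ∧ y i.succ = t)
    (fun i : Fin K => x i.succ = s ∧ edgeFlowSwap (Equiv.refl S) 0 (κ r).succ y i.succ = t) (κ r)
    (fun j hj => by rw [homSwap_succ_of_ne κ r y hj])]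
  simp only [homSwap_level]

end Counts

/-! ## §3 The lumped bracket, the lumped redraw, the checklist -/
section Entry
variable {cnt : (Fin (K + 1) → S) × (Fin (K + 1) → S) → S → S → ℝ}

/-- **ONE ENTRY OF THE SYNCHRONOUS SWAP BRACKET FOR A TYPE-LUMPED TEST FUNCTION.**  If `F(x,y) = Fl(x_0, y_0, cnt(x,y))` depends on the pair only through the hub pair and
the counts `cnt(x,y)(s,t) = #{i : (x_{i+1}, y_{i+1}) = (s,t)}` of the four level types, then for entry `r` (rung level `l = κ_r + 1`, contents `u = x_l`, `v = y_l`)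
`SW_r(F)(x,y) = min(acc(x_0,u),acc(y_0,v))·Fl(u, v, cnt − 𝟙_{(u,v)} + 𝟙_{(x_0,y_0)}) + (acc(x_0,u) − min)·Fl(u, y_0, cnt − 𝟙_{(u,v)} + 𝟙_{(x_0,v)})`
`+ (acc(y_0,v) − min)·Fl(x_0, v, cnt − 𝟙_{(u,v)} + 𝟙_{(u,y_0)}) + (1 − acc(x_0,u) − acc(y_0,v) + min)·Fl(x_0, y_0, cnt)` (homogeneous cold laws, identity maps). [ours] -/
theorem homStar_entry_bracket_lumped (hμ : ∀ k x, 0 < μ k x) (hhom : ∀ i : Fin K, μ i.succ = μ 1)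
    {α : Fin m → (Fin (K + 1) → S) → ℝ}
    (hα : ∀ r z, α r z = min 1 (tensorFun μ (edgeFlowSwap (Equiv.refl S) 0 (κ r).succ z) / tensorFun μ z))
    {acc : S → S → ℝ} (hacc : ∀ u v, acc u v = min 1 (μ 0 v * μ 1 u / (μ 0 u * μ 1 v)))
    (hcnt : ∀ a s t, cnt a s t = ((univ.filter fun i : Fin K => a.1 i.succ = s ∧ a.2 i.succ = t).card : ℝ))
    {Fl : S → S → (S → S → ℝ) → ℝ} {F : (Fin (K + 1) → S) × (Fin (K + 1) → S) → ℝ}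
    (hF : ∀ a, F a = Fl (a.1 0) (a.2 0) (cnt a)) (r : Fin m) (a : (Fin (K + 1) → S) × (Fin (K + 1) → S)) :
    min (α r a.1) (α r a.2) * F (edgeFlowSwap (Equiv.refl S) 0 (κ r).succ a.1, edgeFlowSwap (Equiv.refl S) 0 (κ r).succ a.2)
      + (α r a.1 - min (α r a.1) (α r a.2)) * F (edgeFlowSwap (Equiv.refl S) 0 (κ r).succ a.1, a.2)
      + (α r a.2 - min (α r a.1) (α r a.2)) * F (a.1, edgeFlowSwap (Equiv.refl S) 0 (κ r).succ a.2)
      + (1 - α r a.1 - α r a.2 + min (α r a.1) (α r a.2)) * F (a.1, a.2)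
    = min (acc (a.1 0) (a.1 (κ r).succ)) (acc (a.2 0) (a.2 (κ r).succ))
        * Fl (a.1 (κ r).succ) (a.2 (κ r).succ) (fun s t => cnt a s t
            - (if a.1 (κ r).succ = s ∧ a.2 (κ r).succ = t then 1 else 0) + (if a.1 0 = s ∧ a.2 0 = t then 1 else 0))
      + (acc (a.1 0) (a.1 (κ r).succ) - min (acc (a.1 0) (a.1 (κ r).succ)) (acc (a.2 0) (a.2 (κ r).succ)))
        * Fl (a.1 (κ r).succ) (a.2 0) (fun s t => cnt a s t
            - (if a.1 (κ r).succ = s ∧ a.2 (κ r).succ = t then 1 else 0) + (if a.1 0 = s ∧ a.2 (κ r).succ = t then 1 else 0))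
      + (acc (a.2 0) (a.2 (κ r).succ) - min (acc (a.1 0) (a.1 (κ r).succ)) (acc (a.2 0) (a.2 (κ r).succ)))
        * Fl (a.1 0) (a.2 (κ r).succ) (fun s t => cnt a s t
            - (if a.1 (κ r).succ = s ∧ a.2 (κ r).succ = t then 1 else 0) + (if a.1 (κ r).succ = s ∧ a.2 0 = t then 1 else 0))
      + (1 - acc (a.1 0) (a.1 (κ r).succ) - acc (a.2 0) (a.2 (κ r).succ)
          + min (acc (a.1 0) (a.1 (κ r).succ)) (acc (a.2 0) (a.2 (κ r).succ))) * Fl (a.1 0) (a.2 0) (cnt a) := by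
  obtain ⟨x, y⟩ := a
  have hb : cnt (edgeFlowSwap (Equiv.refl S) 0 (κ r).succ x, edgeFlowSwap (Equiv.refl S) 0 (κ r).succ y)
      = fun s t => cnt (x, y) s t - (if x (κ r).succ = s ∧ y (κ r).succ = t then 1 else 0) + (if x 0 = s ∧ y 0 = t then 1 else 0) := by
    funext s t; exact homStar_cnt_swap_both κ hcnt r x y s t
  have hl : cnt (edgeFlowSwap (Equiv.refl S) 0 (κ r).succ x, y)
      = fun s t => cnt (x, y) s t - (if x (κ r).succ = s ∧ y (κ r).succ = t then 1 else 0) + (if x 0 = s ∧ y (κ r).succ = t then 1 else 0) := by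
    funext s t; exact homStar_cnt_swap_left κ hcnt r x y s t
  have hr : cnt (x, edgeFlowSwap (Equiv.refl S) 0 (κ r).succ y)
      = fun s t => cnt (x, y) s t - (if x (κ r).succ = s ∧ y (κ r).succ = t then 1 else 0) + (if x (κ r).succ = s ∧ y 0 = t then 1 else 0) := by
    funext s t; exact homStar_cnt_swap_right κ hcnt r x y s t
  rw [hF, hF, hF, hF (x, y)]
  dsimp only
  rw [hb, hl, hr, homSwap_zero, homSwap_zero, homStar_accept_eq_acc κ hμ hhom hα hacc r x, homStar_accept_eq_acc κ hμ hhom hα hacc r y]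

end Entry
section Sum
variable {cnt : (Fin (K + 1) → S) × (Fin (K + 1) → S) → S → S → ℝ} {t : ℝ}

/-- **THE LUMPED BRACKET.**  For a type-lumped test function `F(x,y) = Fl(x_0, y_0, cnt(x,y))` on the homogeneous star with identity maps and a uniform entry list
(`c` entries per cold level), the swap part of `Q·F` is a sum over the FOUR level types weighted by their counts:
`Σ_r (t/m)·SW_r(F)(x,y) = (t/K)·Σ_{(u,v) ∈ S²} cnt(x,y)(u,v)·[min(acc(x_0,u),acc(y_0,v))·Fl(u,v,cnt − 𝟙_{(u,v)} + 𝟙_{(x_0,y_0)}) + (acc(x_0,u) − min)·Fl(u,y_0,cnt − 𝟙_{(u,v)} + 𝟙_{(x_0,v)})`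
`+ (acc(y_0,v) − min)·Fl(x_0,v,cnt − 𝟙_{(u,v)} + 𝟙_{(u,y_0)}) + (1 − acc(x_0,u) − acc(y_0,v) + min)·Fl(x_0,y_0,cnt)]` — the super-harmonicity inequalities of `StarSyncIdleBracket` for such
an `F` (and a lumped `Ψ`) are therefore indexed by the hub pair and the four counts only. [ours] -/
theorem homStar_lumped_bracket (hm : 1 ≤ m) (hμ : ∀ k x, 0 < μ k x) (hhom : ∀ i : Fin K, μ i.succ = μ 1)
    {c : ℕ} (hunif : ∀ i : Fin K, (univ.filter fun r : Fin m => κ r = i).card = c)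
    {α : Fin m → (Fin (K + 1) → S) → ℝ}
    (hα : ∀ r z, α r z = min 1 (tensorFun μ (edgeFlowSwap (Equiv.refl S) 0 (κ r).succ z) / tensorFun μ z))
    {acc : S → S → ℝ} (hacc : ∀ u v, acc u v = min 1 (μ 0 v * μ 1 u / (μ 0 u * μ 1 v)))
    (hcnt : ∀ a s t, cnt a s t = ((univ.filter fun i : Fin K => a.1 i.succ = s ∧ a.2 i.succ = t).card : ℝ))
    {Fl : S → S → (S → S → ℝ) → ℝ} {F : (Fin (K + 1) → S) × (Fin (K + 1) → S) → ℝ}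
    (hF : ∀ a, F a = Fl (a.1 0) (a.2 0) (cnt a)) (a : (Fin (K + 1) → S) × (Fin (K + 1) → S)) :
    ∑ r : Fin m, t / m *
        (min (α r a.1) (α r a.2) * F (edgeFlowSwap (Equiv.refl S) 0 (κ r).succ a.1, edgeFlowSwap (Equiv.refl S) 0 (κ r).succ a.2)
          + (α r a.1 - min (α r a.1) (α r a.2)) * F (edgeFlowSwap (Equiv.refl S) 0 (κ r).succ a.1, a.2)
          + (α r a.2 - min (α r a.1) (α r a.2)) * F (a.1, edgeFlowSwap (Equiv.refl S) 0 (κ r).succ a.2)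
          + (1 - α r a.1 - α r a.2 + min (α r a.1) (α r a.2)) * F (a.1, a.2))
      = t / K * ∑ st : S × S, cnt a st.1 st.2 *
          (min (acc (a.1 0) st.1) (acc (a.2 0) st.2)
              * Fl st.1 st.2 (fun s t' => cnt a s t' - (if st.1 = s ∧ st.2 = t' then 1 else 0) + (if a.1 0 = s ∧ a.2 0 = t' then 1 else 0))
            + (acc (a.1 0) st.1 - min (acc (a.1 0) st.1) (acc (a.2 0) st.2))
              * Fl st.1 (a.2 0) (fun s t' => cnt a s t' - (if st.1 = s ∧ st.2 = t' then 1 else 0) + (if a.1 0 = s ∧ st.2 = t' then 1 else 0))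
            + (acc (a.2 0) st.2 - min (acc (a.1 0) st.1) (acc (a.2 0) st.2))
              * Fl (a.1 0) st.2 (fun s t' => cnt a s t' - (if st.1 = s ∧ st.2 = t' then 1 else 0) + (if st.1 = s ∧ a.2 0 = t' then 1 else 0))
            + (1 - acc (a.1 0) st.1 - acc (a.2 0) st.2 + min (acc (a.1 0) st.1) (acc (a.2 0) st.2)) * Fl (a.1 0) (a.2 0) (cnt a)) := by
  -- each entry through its level
  simp_rw [homStar_entry_bracket_lumped κ hμ hhom hα hacc hcnt hF]
  rw [← Finset.mul_sum]
  -- the summand is a function of the level `κ r`; average over the uniform list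
  rw [uniformList_sum κ hunif (fun i : Fin K =>
      min (acc (a.1 0) (a.1 i.succ)) (acc (a.2 0) (a.2 i.succ))
        * Fl (a.1 i.succ) (a.2 i.succ) (fun s t' => cnt a s t'
            - (if a.1 i.succ = s ∧ a.2 i.succ = t' then 1 else 0) + (if a.1 0 = s ∧ a.2 0 = t' then 1 else 0))
      + (acc (a.1 0) (a.1 i.succ) - min (acc (a.1 0) (a.1 i.succ)) (acc (a.2 0) (a.2 i.succ)))
        * Fl (a.1 i.succ) (a.2 0) (fun s t' => cnt a s t'
            - (if a.1 i.succ = s ∧ a.2 i.succ = t' then 1 else 0) + (if a.1 0 = s ∧ a.2 i.succ = t' then 1 else 0))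
      + (acc (a.2 0) (a.2 i.succ) - min (acc (a.1 0) (a.1 i.succ)) (acc (a.2 0) (a.2 i.succ)))
        * Fl (a.1 0) (a.2 i.succ) (fun s t' => cnt a s t'
            - (if a.1 i.succ = s ∧ a.2 i.succ = t' then 1 else 0) + (if a.1 i.succ = s ∧ a.2 0 = t' then 1 else 0))
      + (1 - acc (a.1 0) (a.1 i.succ) - acc (a.2 0) (a.2 i.succ)
          + min (acc (a.1 0) (a.1 i.succ)) (acc (a.2 0) (a.2 i.succ))) * Fl (a.1 0) (a.2 0) (cnt a))]
  -- group the levels by type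
  rw [sum_eq_sum_pairTypeS (fun i : Fin K => a.1 i.succ) (fun i : Fin K => a.2 i.succ) (fun u v =>
      min (acc (a.1 0) u) (acc (a.2 0) v)
        * Fl u v (fun s t' => cnt a s t' - (if u = s ∧ v = t' then 1 else 0) + (if a.1 0 = s ∧ a.2 0 = t' then 1 else 0))
      + (acc (a.1 0) u - min (acc (a.1 0) u) (acc (a.2 0) v))
        * Fl u (a.2 0) (fun s t' => cnt a s t' - (if u = s ∧ v = t' then 1 else 0) + (if a.1 0 = s ∧ v = t' then 1 else 0))
      + (acc (a.2 0) v - min (acc (a.1 0) u) (acc (a.2 0) v))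
        * Fl (a.1 0) v (fun s t' => cnt a s t' - (if u = s ∧ v = t' then 1 else 0) + (if u = s ∧ a.2 0 = t' then 1 else 0))
      + (1 - acc (a.1 0) u - acc (a.2 0) v + min (acc (a.1 0) u) (acc (a.2 0) v)) * Fl (a.1 0) (a.2 0) (cnt a))]
  -- constants: `(t/m)·c = t/K`
  have hmK : (m : ℝ) = c * K := uniformList_card κ hunif
  have hm0 : (m : ℝ) ≠ 0 := by exact_mod_cast (show m ≠ 0 by omega)
  have hc0 : (c : ℝ) ≠ 0 := fun h => hm0 (by rw [hmK, h, zero_mul])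
  have hK0 : (K : ℝ) ≠ 0 := fun h => hm0 (by rw [hmK, h, mul_zero])
  have e1 : t / m * (c : ℝ) = t / K := by rw [hmK]; field_simp
  rw [← mul_assoc, e1]
  congr 1
  refine sum_congr rfl fun st _ => ?_
  rw [hcnt a st.1 st.2]

end Sum
section Law
variable {M : Fin (K + 1) → S → S → ℝ} {w : Fin (K + 1) → ℝ} {t : ℝ}
variable {cnt : (Fin (K + 1) → S) × (Fin (K + 1) → S) → S → S → ℝ}

omit κ in
omit [Fintype S] in
/-- A shared redraw does not touch the cold levels: the type counts are unchanged. [ours] -/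
theorem homStar_cnt_redraw (hcnt : ∀ a s t, cnt a s t = ((univ.filter fun i : Fin K => a.1 i.succ = s ∧ a.2 i.succ = t).card : ℝ))
    (x y : Fin (K + 1) → S) (v : S) : cnt (update x 0 v, update y 0 v) = cnt (x, y) := by
  funext s t'
  rw [hcnt, hcnt]
  simp only [update_of_ne (Fin.succ_ne_zero _)]

omit κ in
/-- **The shared redraw against a type-lumped test function:** `(R·F)(x,y) = Σ_v μ_0(v)·Fl(v, v, cnt(x,y))`. [ours] -/
theorem homStar_lumped_redraw
    (hcnt : ∀ a s t, cnt a s t = ((univ.filter fun i : Fin K => a.1 i.succ = s ∧ a.2 i.succ = t).card : ℝ))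
    {R : (Fin (K + 1) → S) × (Fin (K + 1) → S) → (Fin (K + 1) → S) × (Fin (K + 1) → S) → ℝ}
    (hR : ∀ a b, R a b = ∑ v : S, μ 0 v * (if b.1 = update a.1 0 v ∧ b.2 = update a.2 0 v then (1 : ℝ) else 0))
    {Fl : S → S → (S → S → ℝ) → ℝ} {F : (Fin (K + 1) → S) × (Fin (K + 1) → S) → ℝ}
    (hF : ∀ a, F a = Fl (a.1 0) (a.2 0) (cnt a)) (a : (Fin (K + 1) → S) × (Fin (K + 1) → S)) :
    (Matrix.mulVec (fun a b => R a b) F) a = ∑ v : S, μ 0 v * Fl v v (cnt a) := by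
  rw [starSync_redraw_mulVec_apply hR F a]
  refine sum_congr rfl fun v _ => ?_
  rw [hF]
  dsimp only
  rw [update_self, update_self, homStar_cnt_redraw hcnt]

/-- **THE LUMPED CERTIFICATE CHECKLIST ⇒ MIXING TIME** (homogeneous star, identity maps, uniform entry list with `c` entries per cold level, idle cold levels, exact hot
redraws).  A type-lumped `F = Fl(x_0,y_0,cnt) ≥ 0` and potential `Ψ = Ψl(x_0,y_0,cnt)` (`0 ≤ Ψ ≤ Ψ_max`, `Ψ ≥ 1` where a cold level differs) satisfying, at every pair, the LUMPED
bracket inequality `(1−t)w_0·Ψ + (t/K)·Σ_{(u,v)} cnt(u,v)·[four-term bracket of `homStar_lumped_bracket`] ≤ (t + (1−t)w_0)·F` and the lumped redraw inequality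
`Σ_v μ_0(v)·Fl(v,v,cnt) ≤ (1−ρ)·Ψ` (`0 < ρ ≤ 1`) give **`t_mix(ε) ≤ ⌈(4/((1−t)w_0·ρ))·log((e·Ψ_max+1)/ε)⌉₊`**. [ours] -/
theorem homStar_mixingTime_le_of_lumped_supersolution [Nonempty S] (hm : 1 ≤ m) (ht0 : 0 ≤ t) (ht1 : t < 1) (hw0 : ∀ k, 0 ≤ w k) (hw00 : 0 < w 0)
    (hw1 : ∑ k, w k = 1) (hμ : ∀ k x, 0 < μ k x) (hμ1 : ∀ k, ∑ u, μ k u = 1) (hM0 : ∀ u v, M 0 u v = μ 0 v)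
    (hidle : ∀ i : Fin K, ∀ u v, M i.succ u v = if v = u then 1 else 0) (hhom : ∀ i : Fin K, μ i.succ = μ 1)
    {c : ℕ} (hunif : ∀ i : Fin K, (univ.filter fun r : Fin m => κ r = i).card = c)
    {acc : S → S → ℝ} (hacc : ∀ u v, acc u v = min 1 (μ 0 v * μ 1 u / (μ 0 u * μ 1 v)))
    (hcnt : ∀ a s t, cnt a s t = ((univ.filter fun i : Fin K => a.1 i.succ = s ∧ a.2 i.succ = t).card : ℝ))
    {Fl Ψl : S → S → (S → S → ℝ) → ℝ} {Ψmax ρ : ℝ} (hF0 : ∀ a : (Fin (K + 1) → S) × (Fin (K + 1) → S), 0 ≤ Fl (a.1 0) (a.2 0) (cnt a))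
    (hΨ0 : ∀ a : (Fin (K + 1) → S) × (Fin (K + 1) → S), 0 ≤ Ψl (a.1 0) (a.2 0) (cnt a))
    (hΨmax : ∀ a : (Fin (K + 1) → S) × (Fin (K + 1) → S), Ψl (a.1 0) (a.2 0) (cnt a) ≤ Ψmax)
    (hΨ1 : ∀ a : (Fin (K + 1) → S) × (Fin (K + 1) → S), (∃ i : Fin K, a.1 i.succ ≠ a.2 i.succ) → 1 ≤ Ψl (a.1 0) (a.2 0) (cnt a))
    (hρ0 : 0 < ρ) (hρ1 : ρ ≤ 1)
    (hbr : ∀ a : (Fin (K + 1) → S) × (Fin (K + 1) → S),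
      (1 - t) * w 0 * Ψl (a.1 0) (a.2 0) (cnt a)
        + t / K * ∑ st : S × S, cnt a st.1 st.2 *
          (min (acc (a.1 0) st.1) (acc (a.2 0) st.2)
              * Fl st.1 st.2 (fun s t' => cnt a s t' - (if st.1 = s ∧ st.2 = t' then 1 else 0) + (if a.1 0 = s ∧ a.2 0 = t' then 1 else 0))
            + (acc (a.1 0) st.1 - min (acc (a.1 0) st.1) (acc (a.2 0) st.2))
              * Fl st.1 (a.2 0) (fun s t' => cnt a s t' - (if st.1 = s ∧ st.2 = t' then 1 else 0) + (if a.1 0 = s ∧ st.2 = t' then 1 else 0))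
            + (acc (a.2 0) st.2 - min (acc (a.1 0) st.1) (acc (a.2 0) st.2))
              * Fl (a.1 0) st.2 (fun s t' => cnt a s t' - (if st.1 = s ∧ st.2 = t' then 1 else 0) + (if st.1 = s ∧ a.2 0 = t' then 1 else 0))
            + (1 - acc (a.1 0) st.1 - acc (a.2 0) st.2 + min (acc (a.1 0) st.1) (acc (a.2 0) st.2)) * Fl (a.1 0) (a.2 0) (cnt a))
      ≤ (t + (1 - t) * w 0) * Fl (a.1 0) (a.2 0) (cnt a))
    (hRF : ∀ a : (Fin (K + 1) → S) × (Fin (K + 1) → S), ∑ v : S, μ 0 v * Fl v v (cnt a) ≤ (1 - ρ) * Ψl (a.1 0) (a.2 0) (cnt a))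
    {ε : ℝ} (hε : 0 < ε) :
    mixingTime (fun y z : Fin (K + 1) → S =>
        t * ptGraphSwap μ (fun r : Fin m => (((0 : Fin (K + 1)), (κ r).succ) : Fin (K + 1) × Fin (K + 1))) (fun _ : Fin m => Equiv.refl S) y z
          + (1 - t) * prodKernel w M y z) (tensorFun μ) ε
      ≤ ⌈1 / ((1 - t) * w 0 * ρ / 4) * Real.log ((Real.exp 1 * Ψmax + 1) / ε)⌉₊ := by
  -- the exact redraw at the hub and idle cold kernels are row-stochastic and reversible (as in S4, any content type)
  have hM : ∀ k, IsRowStochastic (M k) := fun k => by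
    cases k using Fin.cases with
    | zero => exact ⟨fun u v => by rw [hM0]; exact (hμ 0 v).le, fun u => by simp_rw [hM0]; exact hμ1 0⟩
    | succ i =>
      refine ⟨fun u v => by rw [hidle]; split_ifs <;> norm_num, fun u => ?_⟩
      simp_rw [hidle i]
      rw [Finset.sum_ite_eq' univ u, if_pos (mem_univ _)]
  have hMrev : ∀ k, DetailedBalance (μ k) (M k) := fun k => by
    intro u v
    cases k using Fin.cases with
    | zero => rw [hM0, hM0, mul_comm]
    | succ i =>
      rw [hidle, hidle]
      by_cases huv : u = v
      · subst huv; rfl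
      · rw [if_neg (Ne.symm huv), if_neg huv, mul_zero, mul_zero]
  -- the data of the synchronous coupling, instantiated by `rfl`
  let α : Fin m → (Fin (K + 1) → S) → ℝ := fun r z => min 1 (tensorFun μ (edgeFlowSwap (Equiv.refl S) 0 (κ r).succ z) / tensorFun μ z)
  have hα : ∀ r z, α r z = min 1 (tensorFun μ (edgeFlowSwap ((fun _ : Fin m => Equiv.refl S) r) 0 (κ r).succ z) / tensorFun μ z) := fun r z => rfl
  let R : (Fin (K + 1) → S) × (Fin (K + 1) → S) → (Fin (K + 1) → S) × (Fin (K + 1) → S) → ℝ := fun a b =>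
      ∑ v : S, μ 0 v * (if b.1 = update a.1 0 v ∧ b.2 = update a.2 0 v then (1 : ℝ) else 0)
  have hR : ∀ a b, R a b = ∑ v : S, μ 0 v * (if b.1 = update a.1 0 v ∧ b.2 = update a.2 0 v then (1 : ℝ) else 0) := fun a b => rfl
  let F : (Fin (K + 1) → S) × (Fin (K + 1) → S) → ℝ := fun a => Fl (a.1 0) (a.2 0) (cnt a)
  have hF : ∀ a, F a = Fl (a.1 0) (a.2 0) (cnt a) := fun a => rfl
  let Ψ : (Fin (K + 1) → S) × (Fin (K + 1) → S) → ℝ := fun a => Ψl (a.1 0) (a.2 0) (cnt a)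
  refine starCycle_mixingTime_le_of_idle_supersolution κ (fun _ : Fin m => Equiv.refl S) hm ht0 ht1 hw0 hw00 hw1 hμ hμ1 hM hMrev hM0 hidle hα
    (Q := fun a b => ∑ r : Fin m, t / m *
        (min (α r a.1) (α r a.2) * (if b.1 = edgeFlowSwap (Equiv.refl S) 0 (κ r).succ a.1
              ∧ b.2 = edgeFlowSwap (Equiv.refl S) 0 (κ r).succ a.2 then (1 : ℝ) else 0)
          + (α r a.1 - min (α r a.1) (α r a.2)) * (if b.1 = edgeFlowSwap (Equiv.refl S) 0 (κ r).succ a.1 ∧ b.2 = a.2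
              then (1 : ℝ) else 0)
          + (α r a.2 - min (α r a.1) (α r a.2)) * (if b.1 = a.1 ∧ b.2 = edgeFlowSwap (Equiv.refl S) 0 (κ r).succ a.2
              then (1 : ℝ) else 0)
          + (1 - α r a.1 - α r a.2 + min (α r a.1) (α r a.2)) * (if b.1 = a.1 ∧ b.2 = a.2 then (1 : ℝ) else 0))
      + (1 - t) * ∑ k : Fin (K + 1), w k *
        (if a.1 k = a.2 k ∨ k = 0 then
            ∑ v : S, M k (a.1 k) v * (if b.1 = update a.1 k v ∧ b.2 = update a.2 k v then (1 : ℝ) else 0)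
          else coordKernel M k a.1 b.1 * coordKernel M k a.2 b.2))
    (fun a b => rfl) (R := R) hR (M' := fun a b => _ ) (fun a b => rfl) (ind := fun a => if a.1 = a.2 then 0 else 1) (fun a => rfl)
    (Ψ := Ψ) (Ψmax := Ψmax) (ρ := ρ) hΨ0 hΨmax hΨ1 hρ0 hρ1 (F := F) hF0 (fun a => ?_) (fun a => ?_) hε
  · -- the bracket inequality, lumped
    have hb := homStar_lumped_bracket κ (t := t) hm hμ hhom hunif hα hacc hcnt hF a
    rw [hb]
    exact hbr a
  · rw [homStar_lumped_redraw hcnt hR hF a]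
    exact hRF a

end Law
end Summit.Ventures.LatticeQCDFlow.Scaling

end
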